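import Summits.BirchSwinnertonDyer.Rank1Residual.Additive.BranchPAdicGrossZagierUpperHalf
import Summits.BirchSwinnertonDyer.Rank1Residual.Additive.GordBranchPAdicGrossZagierConverse
import HarnessLib

/-!
# T-O7c (v): the X3♯(G-ord) twins (REDUCIBLE `E[p]`, defect 2, both parities, every `p` — NO image
# hypothesis): a cell-agnostic CONVERSE core, and on X3♯(G-ord) ∩ `I₀*` in analytic rank one the
# UPPER half from [typed branch `p`-adic Gross–Zagier + Wuthrich 2014 Thm. 16 (published)] and the
# CONVERSE [BSD(E,p) ∧ branch IMC ∧ (B) ⟹ typed `p`-adic GZ] (cell `b2b-bsdres`, team n1011, seat p01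
# GEN 2, OWNERS row T-O7c; X3 twin of `GordBranchPAdicGrossZagier{,Odd}Converse.lean` and of
# `BranchPAdicGrossZagierUpperHalf.lean` §2)

HONEST FRAMING (cell `b2b-bsdres`, run/shared/lean/b2b/bsd-rank1-residual/, verbatim in every
file): prove what is provable now; shrink each hard class to its core with data; no claim beyond
stated classes. Research routes; census output = EVIDENCE / conjecture items, never a Literature
fact; RESIDUAL-MAP marks change only by signed lines. §I O7 stays OPEN; X3♯(G-ord) stays
CONSTRUCTION-SHAPED; nothing is booked; no label changes. COVERAGE (stated first, referee 1
proviso): X3♯(G-ord) ∩ `I₀*` — `E/ℚ` additive at `p` with REDUCIBLE `E[p]`, potentially good ordinary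
of type (G) with semistability defect `2` (`E = V ⊗ χ_{p*}`, `V` good ordinary), analytic rank `1`,
`p ≡ 1 (mod 4)` (even branch, `BranchPAdicGrossZagierAt`) or `p ≡ 3 (mod 4)` incl. `p = 3` (odd branch,
`BranchPAdicGrossZagierOddAt`); NO surjectivity / tower / `p ≥ 5` / CM hypothesis in this file (the
UPPER input is Wuthrich 2014 Thm. 16 on the half-eigenspace for reducible `V[p]`,
`Wuthrich2014.thm16_halfEigenCharIdeal_dvd_cyclotomicPrime`, through additive-p2's full-series brick
`isTorsion_and_exists_iota_eq_branch_of_wuthrichComponent` and lit-kato's `_of_half` bridge); a height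
datum `Dh` with Delbourgo's (B)-clauses, the Schneider rider and `ℓ_p = 1` (`hna`) where the exact
leading term is used (converse), NOT for the upper half. NO definition, NO Literature fact minted, NO
`_holds`; theorems only. p10/p07's caveat applies to the LOWER input on X3 (for reducible `E[p]` the
Néron-normalised `ChiBranchLowerDivisibility[Odd]At` is OUR conjecture and may be the wrong
normalisation by a `p`-power on some rows — it enters the converse as a HYPOTHESIS only).

## What

* §0 CORE `exists_unit_pgz_of_lower_of_upper_of_bsdp` (cell-agnostic; the common tail of the three
  converses of this row, factored out): for ONE cyclotomic dual datum with generator `fE`, an UPPER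
  identity `ι g = C(u·ϖ)·B` (`g ∈ char`) and a LOWER identity `ι fE = ι h·(ϖ·B)` for the same
  `(ϖ, B)`, the (B)-clauses with rider and `ℓ = 1`, `BSD(E,p)` and `r_an = 1` ⟹ the `p`-adic
  Gross–Zagier identity `L'(E,1) = q·Ω_E·Reg_∞ ∧ ϖ·[T^r]B·log_p γ^r = u'·q·Reg_p(E,Dh)`.
* §1 X3♯(G-ord) UPPER half from the typed `p`-adic GZ + Wuthrich's half (even / odd), via
  `missingUpperBoundAt_rankOne_of_iota_eq_of_pgz` (`BranchPAdicGrossZagierUpperHalf.lean` §1). The even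
  form is the RIDER variant (`…_of_wuthrichHalf_of_schneider_of_branchPAdicGrossZagier`) of additive-p2's
  weak-certificate theorem `ClassX3Gord.missingUpperBoundAt_rankOne_of_wuthrichHalf_of_branchPAdicGrossZagier`
  (`GordRankOneKatoBranchGrossZagierX3.lean`, p255353, landed first; anti-collision line INBOX 08:05Z).
* §2 X3♯(G-ord) CONVERSES (even / odd): `BSDp ∧ (B) ∧ rider ∧ ℓ = 1 ∧ typed LOWER ∧ Wuthrich's half ⟹
  BranchPAdicGrossZagier[Odd]At W p Dh`.
The forward lower class forms and the `BSDp ↔ typed p-adic GZ` iffs on X3♯(G-ord) are the sequel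
`X3GordBranchPAdicGrossZagierIff.lean`.

References: [Wuthrich2014] Thm. 16 (p. 397), §3 (p. 390); [Delbourgo2002] Thm. (B); [Kato2004Asterisque]
§17 (shape); [MazurTateTeitelbaum1986Invent] §I.13–I.14; [Miller2011LMS] Def. 1.1; [GreenbergLNM1716] §5.
-/

noncomputable section

open scoped Classical MatrixGroups ModularForm NumberField

open CongruenceSubgroup WeierstrassCurve NumberField Literature.NumberTheory.EllipticCurves
  Literature.NumberTheory.EllipticCurves.ModularForms
  Literature.NumberTheory.EllipticCurves.Rank1Residual
  Literature.NumberTheory.EllipticCurves.Rank1Residual.Typed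
  Literature.NumberTheory.EllipticCurves.Delbourgo2002
  Literature.NumberTheory.GaloisRepresentations
  IsDedekindDomain

namespace Summit.BirchSwinnertonDyer.Rank1Residual.Additive

variable {W : WeierstrassCurve ℚ} [W.IsElliptic] {p : ℕ} [hp : Fact p.Prime]

/-! ### §0 Core: lower ∧ upper for one datum ∧ (B) ∧ rider ∧ `BSD(E,p)` ⟹ the `p`-adic GZ identity -/

/-- **CONVERSE CORE (cell-agnostic, rank one).** Let `p ≠ 2`, `r_an(E) = 1`, `BSD(E,p)` (Miller),
modularity (`L'(E,1) ≠ 0`), `Dh` a (B)-datum with the Schneider rider, non-anomalous (`ℓ = 1`), `D` a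
cyclotomic dual datum with `X` torsion and generator `fE`, an UPPER identity `ι g = C(u·ϖ)·B` for some
`g ∈ char_Λ X` (Kato / Wuthrich) and a LOWER identity `ι fE = ι h·(ϖ·B)` (the branch main conjecture's
`⊇` half for this datum). Then the `p`-adic Gross–Zagier identity holds for `(ϖ, B)`:
`L'(E,1) = q·Ω_E·Reg_∞` and `ϖ·[T^r]B·log_p γ^r = u'·q·Reg_p(E,Dh)` (`r = rank E(ℚ) = 1`,
`q = #Ш_an·∏c/#T²`, `u' = h(0)⁻¹·u_B·#Ш[p^∞]/#Ш_an ∈ ℤ_p^×`). The common tail of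
`branchPAdicGrossZagier[Odd]At_of_bsdp_…` and `PotMult.branchPAdicGrossZagierMultAt_of_bsdp_…`.
[cite: Delbourgo2002, Theorem (B) (p. 40)] [cite: Miller2011LMS, Def. 1.1] [cite: Washington1997, §7.1] -/
theorem exists_unit_pgz_of_lower_of_upper_of_bsdp (hp2 : p ≠ 2) (hmod : hasEntireLFunction_rat)
    (hr : W.analyticRank = 1) (hbsd : BSDp W p) {Dh : PAdicHeightData W p}
    (hB : LeadingTermClauses W p Dh) (hS : SchneiderConjecture Dh) (hna : ReductionNonAnomalous W p)
    {κ : ZpExtension ℚ p} {γ : Field.absoluteGaloisGroup ℚ}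
    (hκ : κ.IsCyclotomic) (hγ : κ.IsTopGenerator γ) (hγ' : IsCyclotomicVariable p γ)
    (D : W.SelmerDualData κ γ) [Module.Finite (IwasawaAlgebra p) D.X] (hXt : D.IsTorsion)
    {fE g : IwasawaAlgebra p} (hchar : D.charIdeal = Ideal.span {fE}) (hg : g ∈ D.charIdeal)
    {u : ℤ_[p]ˣ} {ϖ : ℚ} {B : PowerSeries ℚ_[p]}
    (hι : iwasawaToPowerSeries p g = PowerSeries.C (((u : ℤ_[p]) : ℚ_[p]) * (ϖ : ℚ_[p])) * B)
    {h : IwasawaAlgebra p}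
    (hlow : iwasawaToPowerSeries p fE =
      iwasawaToPowerSeries p h * (PowerSeries.C ((ϖ : ℚ) : ℚ_[p]) * B)) :
    ∃ (u' : ℤ_[p]ˣ) (q : ℚ),
      W.leadingLCoeff = (q : ℂ) * (W.realPeriodRat : ℂ) * (W.regulator : ℂ) ∧
      ((ϖ : ℚ) : ℚ_[p]) * PowerSeries.coeff W.mordellWeilRank B *
          padicLog p (cyclotomicGenerator p) ^ W.mordellWeilRank =
        ((u' : ℤ_[p]) : ℚ_[p]) * (q : ℚ_[p]) * padicRegulator Dh := by
  have hpP : p.Prime := hp.out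
  obtain ⟨hrank, hfinp, s, hs, hvs⟩ := hbsd
  have hmw : W.mordellWeilRank = 1 := by rw [hrank, hr]
  set G : PowerSeries ℚ_[p] := PowerSeries.C ((ϖ : ℚ) : ℚ_[p]) * B with hG_def
  -- UPPER: `ι (k·fE) = C(u)·G`
  have hgspan : g ∈ Ideal.span {fE} := by rw [← hchar]; exact hg
  obtain ⟨k, hk⟩ := Ideal.mem_span_singleton'.mp hgspan
  have hup : iwasawaToPowerSeries p (k * fE) = PowerSeries.C ((u : ℤ_[p]) : ℚ_[p]) * G := by
    rw [hk, hι, hG_def, ← mul_assoc, ← map_mul]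
  -- (B): `fE(0) = 0` and the exact leading term (ℓ = 1)
  have hord1 : (W.mordellWeilRank : ℕ∞) ≤ fE.order := (hB κ γ hκ hγ hγ' D hXt fE hchar).1
  have h0 : PowerSeries.constantCoeff fE = 0 := by
    rw [← PowerSeries.coeff_zero_eq_constantCoeff_apply]
    refine PowerSeries.coeff_of_lt_order 0 ?_
    rw [hmw, Nat.cast_one] at hord1
    exact lt_of_lt_of_le (by exact_mod_cast zero_lt_one) hord1
  obtain ⟨uB, hBeq⟩ := hB.leadingCoeff_of_nonAnomalous hκ hγ hγ' D hXt hchar hS hfinp hna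
  rw [hmw, pow_one] at hBeq
  -- positivity / non-vanishing
  have hT0 : W.torsionOrder ≠ 0 := (W.torsionOrder_pos_holds).ne'
  have hTQ : (W.torsionOrder : ℚ_[p]) ≠ 0 := by exact_mod_cast hT0
  have hT2Q : (W.torsionOrder : ℚ_[p]) ^ 2 ≠ 0 := pow_ne_zero 2 hTQ
  have hPpos : 0 < W.tamagawaProduct := W.tamagawaProduct_pos_holds
  have hCQ : (W.tamagawaProduct : ℚ_[p]) ≠ 0 := by exact_mod_cast hPpos.ne'
  have hShp0 : (Nat.card (AddCommGroup.primaryComponent W.sha p) : ℚ_[p]) ≠ 0 := by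
    exact_mod_cast Nat.card_pos.ne'
  have huB0 : ((uB : ℤ_[p]) : ℚ_[p]) ≠ 0 := coe_units_ne_zero p uB
  have hRegp : padicRegulator Dh ≠ 0 := hS
  have hlog : padicLog p (cyclotomicGenerator p : ℚ_[p]) ≠ 0 := by
    obtain ⟨uγ, huγ⟩ := exists_unit_padicLog_cyclotomicGenerator p hp2
    rw [huγ]
    exact mul_ne_zero (Nat.cast_ne_zero.mpr hpP.ne_zero) (coe_units_ne_zero p uγ)
  have h1 : PowerSeries.coeff 1 fE ≠ 0 := by
    intro hz
    rw [hz, PadicInt.coe_zero, zero_mul, zero_mul] at hBeq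
    exact mul_ne_zero huB0 (mul_ne_zero (mul_ne_zero hShp0 hRegp) hCQ) hBeq.symm
  -- gen 1 §1: `[T¹] G = w · [T¹] fE`, `w ∈ ℤ_p^×`
  obtain ⟨w, hw⟩ := exists_unit_coeff_one_eq_of_lower_of_upper p hlow hup h0 h1
  -- the rational `q` (definition of the analytic Ш)
  have hΩpos : 0 < W.realPeriodRat := W.realPeriodRat_pos_holds
  have hRegpos : 0 < W.regulator := regulator_pos_holds W
  set q : ℚ := s * (W.tamagawaProduct : ℚ) / (W.torsionOrder : ℚ) ^ 2 with hq_def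
  have hlead : W.leadingLCoeff = (q : ℂ) * (W.realPeriodRat : ℂ) * (W.regulator : ℂ) := by
    have hΩC : (W.realPeriodRat : ℂ) ≠ 0 := by exact_mod_cast hΩpos.ne'
    have hRegC : (W.regulator : ℂ) ≠ 0 := by exact_mod_cast hRegpos.ne'
    have hTC : (W.torsionOrder : ℂ) ≠ 0 := by exact_mod_cast hT0
    have hPC : (W.tamagawaProduct : ℂ) ≠ 0 := by exact_mod_cast hPpos.ne'
    have h := hs
    rw [shaAn_def] at h
    rw [hq_def]
    push_cast
    rw [div_eq_iff (mul_ne_zero (mul_ne_zero hΩC hPC) hRegC)] at h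
    field_simp
    linear_combination h
  have hL0 : W.leadingLCoeff ≠ 0 := W.leadingLCoeff_ne_zero_holds (hmod W)
  have hs0 : s ≠ 0 := by
    intro hz
    apply hL0
    rw [hlead, hq_def, hz]
    simp
  -- the unit `#Ш[p^∞] / #Ш_an` — this is where `BSD(E,p)` enters
  have hsQ : ((s : ℚ) : ℚ_[p]) ≠ 0 := by exact_mod_cast hs0
  set t : ℚ_[p] := (Nat.card (AddCommGroup.primaryComponent W.sha p) : ℚ_[p]) / ((s : ℚ) : ℚ_[p])
    with ht_def
  have hnorm : ‖t‖ = 1 := by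
    have hnS : ‖(Nat.card (AddCommGroup.primaryComponent W.sha p) : ℚ_[p])‖ = ‖((s : ℚ) : ℚ_[p])‖ := by
      rw [Padic.norm_eq_zpow_neg_valuation hShp0, Padic.norm_eq_zpow_neg_valuation hsQ,
        Padic.valuation_natCast, Padic.valuation_ratCast, hvs]
    rw [ht_def, norm_div, hnS, div_self (norm_ne_zero_iff.mpr hsQ)]
  obtain ⟨wS, hwS⟩ := exists_unit_coe_eq_of_norm_eq_one p hnorm
  -- assemble
  refine ⟨w * uB * wS, q, hlead, ?_⟩
  have hG1 : PowerSeries.coeff 1 G = ((ϖ : ℚ) : ℚ_[p]) * PowerSeries.coeff 1 B := by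
    rw [hG_def, PowerSeries.coeff_C_mul]
  have hf1 : ((PowerSeries.coeff 1 fE : ℤ_[p]) : ℚ_[p]) =
      ((uB : ℤ_[p]) : ℚ_[p]) *
          ((Nat.card (AddCommGroup.primaryComponent W.sha p) : ℚ_[p]) * padicRegulator Dh *
            W.tamagawaProduct) /
        (padicLog p (cyclotomicGenerator p : ℚ_[p]) * (W.torsionOrder : ℚ_[p]) ^ 2) := by
    rw [eq_div_iff (mul_ne_zero hlog hT2Q), ← hBeq]
    ring
  rw [hmw, pow_one, ← hG1, hw, Units.val_mul, Units.val_mul, PadicInt.coe_mul, PadicInt.coe_mul, hwS,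
    ht_def, hq_def, hf1]
  push_cast
  field_simp

/-! ### §1 X3♯(G-ord): the UPPER half from the typed `p`-adic GZ + Wuthrich 2014 Thm. 16 -/

/-- **X3♯(G-ord) ∩ `I₀*` (reducible `E[p]`), `p ≡ 1 (mod 4)`, `r_an = 1`: the typed EVEN-branch `p`-adic
Gross–Zagier for ONE (B)-datum with the rider + Wuthrich's half-eigenspace divisibility (published,
Thm. 16: reducible `V[p]`, NO image hypothesis) ⟹ the UPPER half `Typed.MissingUpperBoundAt W p`** —
NO non-anomalous / CM / surjectivity hypothesis. Twist datum DISCHARGED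
(`ClassX3Gord.exists_goodOrd_pStar_twist_model`, `hmodD`). RIDER VARIANT (Schneider hypothesis `hS`
for THIS `Dh`) of additive-p2's WEAK-CERTIFICATE form
`ClassX3Gord.missingUpperBoundAt_rankOne_of_wuthrichHalf_of_branchPAdicGrossZagier`
(`GordRankOneKatoBranchGrossZagierX3.lean`, p255353, binder `BranchCoeffOneNeZeroAt W p`; landed first —
credited, not restated: the two hypotheses sets differ). [cite: Wuthrich2014, Thm. 16 (p. 397)]
[cite: Delbourgo2002, Theorem (B) (p. 40)] [cite: Miller2011LMS, Def. 1.1] -/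
theorem ClassX3Gord.missingUpperBoundAt_rankOne_of_wuthrichHalf_of_schneider_of_branchPAdicGrossZagier
    [W.IsGloballyMinimal] (hWu : Wuthrich2014.thm16_halfEigenCharIdeal_dvd_cyclotomicPrime)
    (hGZK : rank_eq_analyticRank_of_analyticRank_le_one) (hmod : hasEntireLFunction_rat)
    (hmodD : nonempty_modularParametrizationData) (hX : ClassX3Gord W p)
    (he : semistabilityIndex W p = 2) (hp4 : p % 4 = 1) (hr : W.analyticRank = 1)
    {Dh : PAdicHeightData W p} (hB : LeadingTermClauses W p Dh) (hS : SchneiderConjecture Dh)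
    (hGZ : BranchPAdicGrossZagierAt W p Dh) : MissingUpperBoundAt W p := by
  have hp2 : p ≠ 2 := by omega
  have heven : Even (p / 2) := ⟨p / 4, by omega⟩
  obtain ⟨V, iV, iVm, C, hV, hC⟩ := ClassX3Gord.exists_goodOrd_pStar_twist_model W p hp2 hX he
  haveI : NeZero (V.conductorNorm ℤ) := ⟨(V.conductorNorm_pos_holds).ne'⟩
  obtain ⟨Dm⟩ := hmodD V
  obtain ⟨ϖ, -, hϖ, -⟩ := Dm.exists_rat_mul_realPeriodRat_eq_plusPeriod
  have hps : ((-1 : ℚ) ^ (p / 2) * (p : ℚ)) = (p : ℚ) := by rw [heven.neg_one_pow, one_mul]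
  have hVW : ∃ C : VariableChange ℚ, C • V.quadraticTwist (p : ℚ) = W := ⟨C, by rw [← hps]; exact hC⟩
  obtain ⟨κ, γ, hκ, hγ, hγ', D, fE, hchar⟩ := exists_cyclotomic_dualData_generator W p
  haveI : Module.Finite (IwasawaAlgebra p) D.X :=
    SelmerDualData.module_finite_of_isCyclotomic (W := W) (κ := κ) hκ D hγ
  have hj := padicValRat_j_nonneg_of_typeGOrd W p hX.typeGOrd
  have hϖ' : (if Even (p / 2) then (ϖ : ℝ) * V.realPeriodRat = plusPeriod Dm.f
      else (ϖ : ℝ) * V.imaginaryPeriodRat = minusPeriod Dm.f) := by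
    rw [if_pos heven]; exact hϖ
  obtain ⟨hXt, g, hg, u, hι⟩ := isTorsion_and_exists_iota_eq_branch_of_wuthrichComponent W p
    (Wuthrich2014.charIdeal_dvd_padicLFunctionBranch_component_of_half hWu) hj hp2 V ⟨C, hC⟩
    (Or.inl hV) hX.classX3.1 hκ hγ hγ' Dm.isNewformOf D ϖ hϖ'
  rw [if_pos heven] at hι
  obtain ⟨u', q, hlead, hpgz⟩ := hGZ V hp4 hVW hV Dm.isNewformOf ϖ hϖ
  exact missingUpperBoundAt_rankOne_of_iota_eq_of_pgz hp2 hGZK hmod hr hB hS hκ hγ hγ' D hXt hchar hg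
    hι hlead hpgz

/-- **X3♯(G-ord) ∩ `I₀*` (reducible `E[p]`), `p ≡ 3 (mod 4)` (`p = 3` INCLUDED), `r_an = 1`: the typed
ODD-branch `p`-adic Gross–Zagier for ONE (B)-datum with the rider + Wuthrich's half ⟹ the UPPER half.**
[cite: Wuthrich2014, Thm. 16 (p. 397)] [cite: Delbourgo2002, Theorem (B) (p. 40)] [cite: Miller2011LMS, Def. 1.1] -/
theorem ClassX3Gord.missingUpperBoundAt_rankOne_of_wuthrichHalf_of_branchPAdicGrossZagierOdd
    [W.IsGloballyMinimal] (hWu : Wuthrich2014.thm16_halfEigenCharIdeal_dvd_cyclotomicPrime)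
    (hGZK : rank_eq_analyticRank_of_analyticRank_le_one) (hmod : hasEntireLFunction_rat)
    (hmodD : nonempty_modularParametrizationData) (hX : ClassX3Gord W p)
    (he : semistabilityIndex W p = 2) (hp4 : p % 4 = 3) (hr : W.analyticRank = 1)
    {Dh : PAdicHeightData W p} (hB : LeadingTermClauses W p Dh) (hS : SchneiderConjecture Dh)
    (hGZ : BranchPAdicGrossZagierOddAt W p Dh) : MissingUpperBoundAt W p := by
  have hp2 : p ≠ 2 := by omega
  have hodd : ¬ Even (p / 2) := by
    rw [Nat.not_even_iff_odd]
    exact ⟨p / 4, by omega⟩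
  obtain ⟨V, iV, iVm, C, hV, hC⟩ := ClassX3Gord.exists_goodOrd_pStar_twist_model W p hp2 hX he
  haveI : NeZero (V.conductorNorm ℤ) := ⟨(V.conductorNorm_pos_holds).ne'⟩
  obtain ⟨Dm⟩ := hmodD V
  obtain ⟨ϖ, -, hϖ⟩ := exists_rat_mul_imaginaryPeriodRat_eq_minusPeriod Dm
  have hps : ((-1 : ℚ) ^ (p / 2) * (p : ℚ)) = -(p : ℚ) := by
    rw [pStar_eq_of_mod_four p (Or.inr hp4), if_neg (by omega)]
  have hVW : ∃ C : VariableChange ℚ, C • V.quadraticTwist (-(p : ℚ)) = W :=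
    ⟨C, by rw [← hps]; exact hC⟩
  obtain ⟨κ, γ, hκ, hγ, hγ', D, fE, hchar⟩ := exists_cyclotomic_dualData_generator W p
  haveI : Module.Finite (IwasawaAlgebra p) D.X :=
    SelmerDualData.module_finite_of_isCyclotomic (W := W) (κ := κ) hκ D hγ
  have hj := padicValRat_j_nonneg_of_typeGOrd W p hX.typeGOrd
  have hϖ' : (if Even (p / 2) then (ϖ : ℝ) * V.realPeriodRat = plusPeriod Dm.f
      else (ϖ : ℝ) * V.imaginaryPeriodRat = minusPeriod Dm.f) := by
    rw [if_neg hodd]; exact hϖ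
  obtain ⟨hXt, g, hg, u, hι⟩ := isTorsion_and_exists_iota_eq_branch_of_wuthrichComponent W p
    (Wuthrich2014.charIdeal_dvd_padicLFunctionBranch_component_of_half hWu) hj hp2 V ⟨C, hC⟩
    (Or.inl hV) hX.classX3.1 hκ hγ hγ' Dm.isNewformOf D ϖ hϖ'
  rw [if_neg hodd] at hι
  obtain ⟨u', q, hlead, hpgz⟩ := hGZ V hp4 hVW hV Dm.isNewformOf ϖ hϖ
  exact missingUpperBoundAt_rankOne_of_iota_eq_of_pgz hp2 hGZK hmod hr hB hS hκ hγ hγ' D hXt hchar hg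
    hι hlead hpgz

/-! ### §2 X3♯(G-ord): the CONVERSES (`BSD(E,p)` ∧ branch IMC ∧ (B) ⟹ typed `p`-adic GZ) -/

/-- **CONVERSE on X3♯(G-ord) (reducible `E[p]`), even branch `p ≡ 1 (mod 4)`, rank one, every such
`p`.** `BSD(E,p)` ∧ the (B)-clauses for `Dh` with the rider ∧ `ℓ_p = 1` ∧ p07's LOWER
`ChiBranchLowerDivisibilityAt W p` (OUR conjecture; on X3 its Néron normalisation is part of the
conjecture, p07/p10 caveat) ∧ Wuthrich's half (Thm. 16, published, NO image hypothesis) ⟹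
`BranchPAdicGrossZagierAt W p Dh`. The X3 twin of gen 1's
`branchPAdicGrossZagierAt_of_bsdp_of_chiBranchLower_of_kato` (same core §0). NO Birch/Pal/GZK binder.
[cite: Wuthrich2014, Thm. 16 (p. 397)] [cite: Delbourgo2002, Theorem (B) (p. 40)] [cite: Miller2011LMS, Def. 1.1] -/
theorem ClassX3Gord.branchPAdicGrossZagierAt_of_bsdp_of_chiBranchLower_of_wuthrichHalf
    (hWu : Wuthrich2014.thm16_halfEigenCharIdeal_dvd_cyclotomicPrime) (hmod : hasEntireLFunction_rat)
    (hX : ClassX3Gord W p) (hr : W.analyticRank = 1) (hna : ReductionNonAnomalous W p)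
    (hbsd : BSDp W p) (hdiv : ChiBranchLowerDivisibilityAt W p) {Dh : PAdicHeightData W p}
    (hB : LeadingTermClauses W p Dh) (hS : SchneiderConjecture Dh) :
    BranchPAdicGrossZagierAt W p Dh := by
  intro V _ _ N _ f hp4 hVW hord hf ϖ hϖ
  have hp2 : p ≠ 2 := by omega
  have heven : Even (p / 2) := ⟨p / 4, by omega⟩
  obtain ⟨C, hC⟩ := hVW
  have hC' : C • V.quadraticTwist ((-1 : ℚ) ^ (p / 2) * p) = W := by
    rw [pStar_eq_self_of_mod_four_eq_one hp4]; exact hC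
  obtain ⟨κ, γ, hκ, hγ, hγ', D, fE, hchar⟩ := exists_cyclotomic_dualData_generator W p
  haveI : Module.Finite (IwasawaAlgebra p) D.X :=
    SelmerDualData.module_finite_of_isCyclotomic (W := W) (κ := κ) hκ D hγ
  have hj := padicValRat_j_nonneg_of_typeGOrd W p hX.typeGOrd
  have hϖ' : (if Even (p / 2) then (ϖ : ℝ) * V.realPeriodRat = plusPeriod f
      else (ϖ : ℝ) * V.imaginaryPeriodRat = minusPeriod f) := by
    rw [if_pos heven]; exact hϖ
  -- UPPER: Wuthrich's half on the component (full series)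
  obtain ⟨hXt, g, hg, u, hι⟩ := isTorsion_and_exists_iota_eq_branch_of_wuthrichComponent W p
    (Wuthrich2014.charIdeal_dvd_padicLFunctionBranch_component_of_half hWu) hj hp2 V ⟨C, hC'⟩
    (Or.inl hord) hX.classX3.1 hκ hγ hγ' hf D ϖ hϖ'
  rw [if_pos heven] at hι
  -- LOWER: p07's typed input
  obtain ⟨h, hlow⟩ := hdiv V hp4 ⟨C, hC⟩ hord hκ hγ hγ' hf D ϖ hϖ fE
    (by rw [hchar]; exact Ideal.mem_span_singleton_self fE)
  exact exists_unit_pgz_of_lower_of_upper_of_bsdp hp2 hmod hr hbsd hB hS hna hκ hγ hγ' D hXt hchar hg hι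
    hlow

/-- **CONVERSE on X3♯(G-ord) (reducible `E[p]`), ODD branch `p ≡ 3 (mod 4)` (`p = 3` INCLUDED), rank
one.** `BSD(E,p)` ∧ (B) with rider ∧ `ℓ_p = 1` ∧ p07's odd LOWER `ChiBranchLowerDivisibilityOddAt W p` ∧
Wuthrich's half ⟹ `BranchPAdicGrossZagierOddAt W p Dh`. [cite: Wuthrich2014, Thm. 16 (p. 397)]
[cite: Delbourgo2002, Theorem (B) (p. 40)] [cite: Miller2011LMS, Def. 1.1] -/
theorem ClassX3Gord.branchPAdicGrossZagierOddAt_of_bsdp_of_chiBranchLowerOdd_of_wuthrichHalf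
    (hWu : Wuthrich2014.thm16_halfEigenCharIdeal_dvd_cyclotomicPrime) (hmod : hasEntireLFunction_rat)
    (hX : ClassX3Gord W p) (hr : W.analyticRank = 1) (hna : ReductionNonAnomalous W p)
    (hbsd : BSDp W p) (hdiv : ChiBranchLowerDivisibilityOddAt W p) {Dh : PAdicHeightData W p}
    (hB : LeadingTermClauses W p Dh) (hS : SchneiderConjecture Dh) :
    BranchPAdicGrossZagierOddAt W p Dh := by
  intro V _ _ N _ f hp4 hVW hord hf ϖ hϖ
  have hp2 : p ≠ 2 := by omega
  have hodd : ¬ Even (p / 2) := by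
    rw [Nat.not_even_iff_odd]
    exact ⟨p / 4, by omega⟩
  obtain ⟨C, hC⟩ := hVW
  have hps : ((-1 : ℚ) ^ (p / 2) * (p : ℚ)) = -(p : ℚ) := by
    rw [pStar_eq_of_mod_four p (Or.inr hp4), if_neg (by omega)]
  have hC' : C • V.quadraticTwist ((-1 : ℚ) ^ (p / 2) * p) = W := by rw [hps]; exact hC
  obtain ⟨κ, γ, hκ, hγ, hγ', D, fE, hchar⟩ := exists_cyclotomic_dualData_generator W p
  haveI : Module.Finite (IwasawaAlgebra p) D.X :=
    SelmerDualData.module_finite_of_isCyclotomic (W := W) (κ := κ) hκ D hγ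
  have hj := padicValRat_j_nonneg_of_typeGOrd W p hX.typeGOrd
  have hϖ' : (if Even (p / 2) then (ϖ : ℝ) * V.realPeriodRat = plusPeriod f
      else (ϖ : ℝ) * V.imaginaryPeriodRat = minusPeriod f) := by
    rw [if_neg hodd]; exact hϖ
  obtain ⟨hXt, g, hg, u, hι⟩ := isTorsion_and_exists_iota_eq_branch_of_wuthrichComponent W p
    (Wuthrich2014.charIdeal_dvd_padicLFunctionBranch_component_of_half hWu) hj hp2 V ⟨C, hC'⟩
    (Or.inl hord) hX.classX3.1 hκ hγ hγ' hf D ϖ hϖ'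
  rw [if_neg hodd] at hι
  obtain ⟨h, hlow⟩ := hdiv V hp4 ⟨C, hC⟩ hord hκ hγ hγ' hf D ϖ hϖ fE
    (by rw [hchar]; exact Ideal.mem_span_singleton_self fE)
  exact exists_unit_pgz_of_lower_of_upper_of_bsdp hp2 hmod hr hbsd hB hS hna hκ hγ hγ' D hXt hchar hg hι
    hlow

end Summit.BirchSwinnertonDyer.Rank1Residual.Additive

end
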